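import Mathlib
import HarnessLib
import Literature.Analysis.ODE.CompactSupportFlow
import Summits.Ventures.LatticeQCDFlow.Exactness.SphereLatticeGreen

/-!
# The gradient flow `ẋ_n = −∂̃_n G(x)` of a `C²` functional on the lattice of site spheres exists for all times: a smooth global flow on `Ω = S(E)^Λ` with the group law, obtained from a compactly supported cut-off field in the ambient space

HONEST FRAMING: exact (Metropolis-corrected) sampling algorithms for lattice gauge theory;
figures of merit are autocorrelation/cost numbers at stated couplings and volumes; no
continuum-physics claim.

Venture `LatticeQCDFlow` (cell pub-lqcd), topic `Exactness`; FANOUT row 7 (`s0-cpn-null`: the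
S0-D1 rung — Lüscher's trivializing flow for the lattice CP(N−1)/O(N) action, Engel–Schaefer 2011,
integrated by Euler steps inside HMC).  NEW WORK of the cell over the tree's
`Literature/Analysis/ODE/CompactSupportFlow.lean` (the global flow `globalFlow` of a globally
Lipschitz bounded field: `globalFlow_zero`, `hasDerivAt_globalFlow`, `eqOn_globalFlow`,
`globalFlow_add`, `contDiff_globalFlow` — Lang, GTM 160, IV §1), Mathlib (`ContDiffBump`,
`ContDiff.lipschitzWith_of_hasCompactSupport`, `is_const_of_deriv_eq_zero`) and the tree's
`Exactness/SphereLatticeGreen.lean` (`contDiffAt_fderiv_section`: the site gradient of a `C²`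
functional is `C¹` off the poles) and `Exactness/SphereTangentialLaplacian.lean` (Euler's relation
`Dν(y)y = 0`); nothing is cited as a fact.  Printed counterpart, NAMED ONLY: M. Lüscher, Commun.
Math. Phys. 293 (2010) 899, §3.1 (the flow equation has a unique solution for all times because the
field manifold is compact) — here for the product of spheres instead of `SU(3)^E` (the gauge-side
analogue is the tree's `TrivializingMaps/FlowExistenceLocal.lean`); Engel–Schaefer, Comput. Phys.
Commun. 182 (2011) 2107, §3 eq. (14) (the gradient ansatz `ẋ_n = −∂̃_n S̃ = T_n`).

GEN-12's NOT-CLAIMED list had "anything about the flow MAP `Φ_t` on the sphere side".  THIS FILE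
constructs it, for every `C²` functional `G` on `Λ → E` (finite `Λ`, finite-dimensional `E`):

* §1 the RADIAL CUT-OFF `sphereCutoff x = Π_n b(‖x_n‖²)` (`b` a smooth bump on `ℝ`, `= 1` on
  `[1/2, 3/2]`, `= 0` off `(1/4, 7/4)`): smooth, `= 1` on `Ω̃ = {x : ‖x_n‖ = 1 ∀n}`, `= 0` near the
  poles `{x_m = 0}` and off the ball of radius `2`;
* §2 the CUT-OFF GRADIENT FIELD `sphereFlowField G x = (n ↦ −χ(x)·∂̃_nG(x))`: `C¹` on the whole
  ambient space (**`contDiff_sphereFlowField`**), compactly supported, hence Lipschitz and bounded;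
  RADIALLY TANGENT: `⟪(sphereFlowField G x) n, x_n⟫ = 0` for all `x` (Euler's relation);
* §3 the GLOBAL FLOW `sphereGradientFlow hG : (Λ → E) → ℝ → (Λ → E)` (Literature `globalFlow`):
  **`norm_sphereGradientFlow_apply`** — every site norm is conserved, `‖Φ_t(x)_n‖ = ‖x_n‖` (the
  derivative of `‖x_n(t)‖²` vanishes identically); hence `Ω̃` is invariant and ON `Ω̃` THE FLOW
  SOLVES THE TRUE EQUATION `ẋ_n = −∂̃_nG(x)` (**`hasDerivAt_sphereGradientFlow`**); the group law
  `Φ_{s+t} = Φ_t ∘ Φ_s`, `Φ_{−t} ∘ Φ_t = id`, joint smoothness in `(x, t)`, and UNIQUENESS: a curve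
  on `Ω̃` solving the true equation through `x` is the flow line (**`eqOn_sphereGradientFlow`**) —
  so the flow on `Ω̃` does not depend on the cut-off;
* §4 the FLOW MAP ON SPHERE CONFIGURATIONS `sphereFlowMap hG t : (Λ → S(E)) → (Λ → S(E))`, an
  `Equiv` with inverse `sphereFlowMap hG (−t)`, continuous (**`continuous_sphereFlowMap`**) and
  measurable, with `sphereFlowMap_zero` and the group law.

NOT CLAIMED: the Jacobian / Liouville formula for `Φ_t` and the push-forward of `π̄` or of
`e^{−tS}π̄` (the trivialization property); time-dependent generators `S̃_t` (Lüscher's actual flow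
uses `∂̃S̃_t` with `t`-dependent `S̃_t` — the autonomous case here covers each fixed-order
truncation used as a time-independent generator, as in E–S's LO map); rates, step-size or
discretisation statements (the rung integrates by Euler steps); anything quantitative.
-/

noncomputable section

namespace Summit.Ventures.LatticeQCDFlow.Exactness

open Function Set Metric MeasureTheory NormedSpace InnerProductSpace Literature.Analysis.ODE
open scoped RealInnerProductSpace NNReal Topology

variable {Λ : Type*} {E : Type*} [NormedAddCommGroup E] [InnerProductSpace ℝ E] [Fintype Λ]

/-! ## §1 The radial cut-off -/

section Cutoff

/-- The radial profile: a smooth bump on `ℝ` centred at `1` with `rIn = 1/2`, `rOut = 3/4`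
(`= 1` on `[1/2, 3/2]`, `= 0` off `(1/4, 7/4)`). -/
def siteRadialBump : ContDiffBump (1 : ℝ) := ⟨1 / 2, 3 / 4, by norm_num, by norm_num⟩

/-- **The configuration cut-off** `χ(x) = Π_n b(‖x_n‖²)`. -/
def sphereCutoff (x : Λ → E) : ℝ := ∏ n, (siteRadialBump : ℝ → ℝ) (‖x n‖ ^ 2)

omit [InnerProductSpace ℝ E] in
/-- `χ = 1` on the product of unit spheres. -/
theorem sphereCutoff_eq_one {x : Λ → E} (hx : ∀ n, ‖x n‖ = 1) : sphereCutoff x = 1 := by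
  unfold sphereCutoff
  refine Finset.prod_eq_one fun n _ => siteRadialBump.one_of_mem_closedBall ?_
  rw [hx n, one_pow, mem_closedBall, dist_self]
  exact siteRadialBump.rIn_pos.le

omit [InnerProductSpace ℝ E] in
/-- `χ = 0` as soon as one site variable is short: `‖x_m‖² ≤ 1/4`. -/
theorem sphereCutoff_eq_zero_of_le {x : Λ → E} {m : Λ} (hm : ‖x m‖ ^ 2 ≤ 1 / 4) :
    sphereCutoff x = 0 := by
  unfold sphereCutoff
  refine Finset.prod_eq_zero (Finset.mem_univ m) (siteRadialBump.zero_of_le_dist ?_)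
  show (3 / 4 : ℝ) ≤ dist (‖x m‖ ^ 2) 1
  rw [Real.dist_eq, abs_of_neg (by linarith)]
  linarith

omit [InnerProductSpace ℝ E] in
/-- `χ = 0` as soon as one site variable is long: `7/4 ≤ ‖x_m‖²`. -/
theorem sphereCutoff_eq_zero_of_ge {x : Λ → E} {m : Λ} (hm : 7 / 4 ≤ ‖x m‖ ^ 2) :
    sphereCutoff x = 0 := by
  unfold sphereCutoff
  refine Finset.prod_eq_zero (Finset.mem_univ m) (siteRadialBump.zero_of_le_dist ?_)
  show (3 / 4 : ℝ) ≤ dist (‖x m‖ ^ 2) 1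
  rw [Real.dist_eq, abs_of_nonneg (by linarith)]
  linarith

omit [InnerProductSpace ℝ E] in
/-- `χ` vanishes off the closed ball of radius `2` (sup norm). -/
theorem sphereCutoff_eq_zero_of_norm {x : Λ → E} (hx : 2 < ‖x‖) : sphereCutoff x = 0 := by
  -- some coordinate has norm `> 3/2`, hence `‖x_m‖² ≥ 7/4`
  by_contra h
  have hle : ‖x‖ ≤ 3 / 2 := by
    refine (pi_norm_le_iff_of_nonneg (by norm_num)).2 fun m => ?_
    by_contra hm
    have hm' : 3 / 2 < ‖x m‖ := lt_of_not_ge hm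
    have : (7 / 4 : ℝ) ≤ ‖x m‖ ^ 2 := by nlinarith
    exact h (sphereCutoff_eq_zero_of_ge this)
  linarith

/-- `χ` is smooth. -/
theorem contDiff_sphereCutoff_top : ContDiff ℝ (⊤ : ℕ∞) (sphereCutoff : (Λ → E) → ℝ) := by
  unfold sphereCutoff
  exact contDiff_prod fun n _ =>
    (ContDiffBump.contDiff (n := ⊤) siteRadialBump).comp ((contDiff_apply ℝ E n).norm_sq ℝ)

/-- `χ` is `C^r` for every finite `r`. -/
theorem contDiff_sphereCutoff (r : ℕ) : ContDiff ℝ r (sphereCutoff : (Λ → E) → ℝ) :=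
  contDiff_infty.1 contDiff_sphereCutoff_top r

omit [InnerProductSpace ℝ E] in
/-- `χ` vanishes on a neighbourhood of every configuration with a short site variable
(`‖x₀_m‖² < 1/4`), in particular near the poles `x₀_m = 0`. -/
theorem sphereCutoff_eventuallyEq_zero {x₀ : Λ → E} {m : Λ} (hm : ‖x₀ m‖ ^ 2 < 1 / 4) :
    (sphereCutoff : (Λ → E) → ℝ) =ᶠ[𝓝 x₀] fun _ => 0 := by
  have hopen : IsOpen {x : Λ → E | ‖x m‖ ^ 2 < 1 / 4} :=
    isOpen_lt ((continuous_apply m).norm.pow 2) continuous_const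
  filter_upwards [hopen.mem_nhds hm] with x hx
  exact sphereCutoff_eq_zero_of_le (le_of_lt hx)

end Cutoff

/-! ## §2 The cut-off gradient field -/

section Field

variable [FiniteDimensional ℝ E] [DecidableEq Λ]

/-- **The cut-off gradient field** `X(x)_n = −χ(x)·∂̃_nG(x)`: on `Ω̃` it is E–S's generator
`T_n = −∂̃_nG` (eq. (14)); the cut-off makes it smooth and compactly supported on the ambient space. -/
def sphereFlowField (G : (Λ → E) → ℝ) (x : Λ → E) : Λ → E :=
  fun n => -(sphereCutoff x • siteGrad n G x)

variable {G : (Λ → E) → ℝ}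

/-- On the product of unit spheres the field is the true generator `−∂̃G`. -/
theorem sphereFlowField_eq_of_norm_eq_one {x : Λ → E} (hx : ∀ n, ‖x n‖ = 1) :
    sphereFlowField G x = fun n => -siteGrad n G x := by
  funext n
  rw [sphereFlowField, sphereCutoff_eq_one hx, one_smul]

/-- **Euler's relation for the site gradient**: `⟪∂̃_nG(x), x_n⟫ = 0` whenever `x_n ≠ 0` (the
section `y ↦ G(x[n ← y/‖y‖])` is homogeneous of degree `0`), for differentiable `G`. -/
theorem inner_siteGrad_self_eq_zero (hG : Differentiable ℝ G) (n : Λ) {x : Λ → E}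
    (hx : x n ≠ 0) : ⟪siteGrad n G x, x n⟫ = 0 := by
  rw [siteGrad, gradient, toDual_symm_apply]
  exact fderiv_comp_normalize_apply_self hx
    ((hG.comp (contDiff_update 1 x n).differentiable_one).differentiableAt)

/-- **The field is radially tangent at every configuration**: `⟪X(x)_n, x_n⟫ = 0` (off the poles
by Euler's relation, at a pole because `x_n = 0`). -/
theorem inner_sphereFlowField_self_eq_zero (hG : Differentiable ℝ G) (x : Λ → E) (n : Λ) :
    ⟪sphereFlowField G x n, x n⟫ = 0 := by
  by_cases hx : x n = 0
  · rw [hx, inner_zero_right]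
  · rw [sphereFlowField, inner_neg_left, real_inner_smul_left, inner_siteGrad_self_eq_zero hG n hx,
      mul_zero, neg_zero]

/-- The site gradient of a `C²` functional is `C¹` off the pole `x_n = 0`. -/
theorem contDiffAt_siteGrad (hG : ContDiff ℝ 2 G) (n : Λ) {x : Λ → E} (hx : x n ≠ 0) :
    ContDiffAt ℝ 1 (fun x' : Λ → E => siteGrad n G x') x := by
  have h := contDiffAt_fderiv_section hG (m := 1) (by norm_num) n hx
  exact (toDual ℝ E).symm.contDiff.comp_contDiffAt x h

/-- **The cut-off field is `C¹` on the whole ambient space** (for `G ∈ C²`): off the poles it is a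
product of smooth and `C¹` maps, and near a pole it vanishes identically. -/
theorem contDiff_sphereFlowField (hG : ContDiff ℝ 2 G) : ContDiff ℝ 1 (sphereFlowField G) := by
  refine contDiff_pi.2 fun n => contDiff_iff_contDiffAt.2 fun x₀ => ?_
  by_cases h : ∀ m, x₀ m ≠ 0
  · exact ((contDiff_sphereCutoff 1).contDiffAt.smul (contDiffAt_siteGrad hG n (h n))).neg
  · simp only [ne_eq, not_forall, not_not] at h
    obtain ⟨m, hm⟩ := h
    have hm' : ‖x₀ m‖ ^ 2 < 1 / 4 := by rw [hm, norm_zero]; norm_num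
    have hev : (fun x : Λ → E => sphereFlowField G x n) =ᶠ[𝓝 x₀] fun _ => 0 := by
      filter_upwards [sphereCutoff_eventuallyEq_zero hm'] with x hx
      simp only [sphereFlowField, hx, zero_smul, neg_zero]
    exact (contDiffAt_const (c := (0 : E))).congr_of_eventuallyEq hev

/-- The cut-off field vanishes off the closed ball of radius `2`. -/
theorem sphereFlowField_eq_zero_of_norm {x : Λ → E} (hx : 2 < ‖x‖) : sphereFlowField G x = 0 := by
  funext n
  simp only [sphereFlowField, sphereCutoff_eq_zero_of_norm hx, zero_smul, neg_zero, Pi.zero_apply]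

/-- **The cut-off field has compact support.** -/
theorem hasCompactSupport_sphereFlowField : HasCompactSupport (sphereFlowField G) :=
  HasCompactSupport.intro (isCompact_closedBall (0 : Λ → E) 2) fun x hx =>
    sphereFlowField_eq_zero_of_norm (by simpa [mem_closedBall, dist_zero_right] using hx)

/-- Hence it is globally Lipschitz (for `G ∈ C²`) … -/
theorem exists_lipschitzWith_sphereFlowField (hG : ContDiff ℝ 2 G) :
    ∃ K : ℝ≥0, LipschitzWith K (sphereFlowField G) :=
  ContDiff.lipschitzWith_of_hasCompactSupport (𝕂 := ℝ) (n := 1)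
    (hasCompactSupport_sphereFlowField (G := G)) (contDiff_sphereFlowField hG) one_ne_zero

/-- … and bounded. -/
theorem exists_bound_sphereFlowField (hG : ContDiff ℝ 2 G) :
    ∃ B : ℝ, ∀ q, ‖sphereFlowField G q‖ ≤ B :=
  (hasCompactSupport_sphereFlowField (G := G)).exists_bound_of_continuous
    (contDiff_sphereFlowField hG).continuous

end Field

/-! ## §3 The global flow and the invariance of the site spheres -/

section Flow

variable [FiniteDimensional ℝ E] [DecidableEq Λ] {G : (Λ → E) → ℝ}

/-- **The gradient flow of `G` on the lattice of site spheres**, realised as the global flow of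
the cut-off field on the ambient space `Λ → E`: `sphereGradientFlow hG x t = Φ_t(x)`. -/
def sphereGradientFlow (hG : ContDiff ℝ 2 G) : (Λ → E) → ℝ → (Λ → E) :=
  globalFlow (exists_lipschitzWith_sphereFlowField hG).choose_spec
    (exists_bound_sphereFlowField hG).choose_spec

/-- `Φ_0 = id`. -/
@[simp]
theorem sphereGradientFlow_zero (hG : ContDiff ℝ 2 G) (x : Λ → E) : sphereGradientFlow hG x 0 = x :=
  globalFlow_zero _ _ x

/-- The flow lines solve the cut-off equation `ẋ = X(x)` everywhere. -/
theorem hasDerivAt_sphereGradientFlow_field (hG : ContDiff ℝ 2 G) (x : Λ → E) (t : ℝ) :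
    HasDerivAt (sphereGradientFlow hG x) (sphereFlowField G (sphereGradientFlow hG x t)) t :=
  hasDerivAt_globalFlow _ _ x t

/-- **The group law** `Φ_{s+t}(x) = Φ_t(Φ_s(x))`. -/
theorem sphereGradientFlow_add (hG : ContDiff ℝ 2 G) (x : Λ → E) (s t : ℝ) :
    sphereGradientFlow hG x (s + t) = sphereGradientFlow hG (sphereGradientFlow hG x s) t :=
  globalFlow_add _ _ x s t

/-- `Φ_{−t} ∘ Φ_t = id`. -/
theorem sphereGradientFlow_neg (hG : ContDiff ℝ 2 G) (x : Λ → E) (t : ℝ) :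
    sphereGradientFlow hG (sphereGradientFlow hG x t) (-t) = x :=
  globalFlow_neg_globalFlow _ _ x t

/-- **Joint smoothness**: `(x, t) ↦ Φ_t(x)` is `C¹`. -/
theorem contDiff_sphereGradientFlow (hG : ContDiff ℝ 2 G) :
    ContDiff ℝ 1 fun p : (Λ → E) × ℝ => sphereGradientFlow hG p.1 p.2 :=
  contDiff_globalFlow (contDiff_sphereFlowField hG) le_rfl _ _

/-- `x ↦ Φ_t(x)` is continuous. -/
theorem continuous_sphereGradientFlow (hG : ContDiff ℝ 2 G) (t : ℝ) :
    Continuous fun x : Λ → E => sphereGradientFlow hG x t :=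
  (contDiff_sphereGradientFlow hG).continuous.comp (continuous_id.prodMk continuous_const)

/-- **EVERY SITE NORM IS CONSERVED ALONG THE FLOW**: `‖Φ_t(x)_n‖ = ‖x_n‖` for all `x`, `t`, `n`
(the derivative of `‖x_n(t)‖²` is `2⟪X(x(t))_n, x_n(t)⟫ = 0`). -/
theorem norm_sphereGradientFlow_apply (hG : ContDiff ℝ 2 G) (x : Λ → E) (t : ℝ) (n : Λ) :
    ‖sphereGradientFlow hG x t n‖ = ‖x n‖ := by
  have hGd : Differentiable ℝ G := hG.differentiable (by norm_num)
  set γ : ℝ → E := fun s => sphereGradientFlow hG x s n with hγ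
  have hγ' : ∀ s, HasDerivAt γ (sphereFlowField G (sphereGradientFlow hG x s) n) s := fun s =>
    (hasDerivAt_pi.1 (hasDerivAt_sphereGradientFlow_field hG x s)) n
  have hsq : ∀ s, HasDerivAt (fun s => ⟪γ s, γ s⟫) 0 s := fun s => by
    have h := (hγ' s).inner ℝ (hγ' s)
    rw [inner_sphereFlowField_self_eq_zero hGd, real_inner_comm,
      inner_sphereFlowField_self_eq_zero hGd, add_zero] at h
    exact h
  have hconst := is_const_of_deriv_eq_zero (f := fun s => ⟪γ s, γ s⟫)
    (fun s => (hsq s).differentiableAt) (fun s => (hsq s).deriv) t 0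
  simp only [hγ, sphereGradientFlow_zero, real_inner_self_eq_norm_sq] at hconst
  exact (sq_eq_sq₀ (norm_nonneg _) (norm_nonneg _)).1 hconst

/-- **The product of unit spheres is invariant**: `‖x_n‖ = 1 ∀n ⇒ ‖Φ_t(x)_n‖ = 1 ∀n`. -/
theorem norm_sphereGradientFlow_eq_one (hG : ContDiff ℝ 2 G) {x : Λ → E} (hx : ∀ n, ‖x n‖ = 1)
    (t : ℝ) (n : Λ) : ‖sphereGradientFlow hG x t n‖ = 1 := by
  rw [norm_sphereGradientFlow_apply hG x t n, hx n]

/-- **ON `Ω̃` THE FLOW SOLVES THE TRUE GRADIENT-FLOW EQUATION** `ẋ_n = −∂̃_nG(x)` (E–S eq. (14)):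
the cut-off is inactive along flow lines started on the product of unit spheres. -/
theorem hasDerivAt_sphereGradientFlow (hG : ContDiff ℝ 2 G) {x : Λ → E} (hx : ∀ n, ‖x n‖ = 1)
    (t : ℝ) :
    HasDerivAt (sphereGradientFlow hG x)
      (fun n => -siteGrad n G (sphereGradientFlow hG x t)) t := by
  have h := hasDerivAt_sphereGradientFlow_field hG x t
  rwa [sphereFlowField_eq_of_norm_eq_one (norm_sphereGradientFlow_eq_one hG hx t)] at h

/-- **UNIQUENESS ON `Ω̃`**: a curve that stays on the product of unit spheres and solves
`ẋ_n = −∂̃_nG(x)` on an open interval around `0` is the flow line of its initial point — in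
particular the flow on `Ω̃` does not depend on the choice of cut-off. -/
theorem eqOn_sphereGradientFlow (hG : ContDiff ℝ 2 G) {γ : ℝ → (Λ → E)} {a b : ℝ}
    (h0 : (0 : ℝ) ∈ Ioo a b) (hsph : ∀ t ∈ Ioo a b, ∀ n, ‖γ t n‖ = 1)
    (hγ : ∀ t ∈ Ioo a b, HasDerivAt γ (fun n => -siteGrad n G (γ t)) t) :
    EqOn γ (sphereGradientFlow hG (γ 0)) (Ioo a b) := by
  refine eqOn_globalFlow _ _ h0 fun t ht => ?_
  rw [sphereFlowField_eq_of_norm_eq_one (hsph t ht)]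
  exact hγ t ht

end Flow

/-! ## §4 The flow map on sphere configurations -/

section Map

variable [FiniteDimensional ℝ E] [DecidableEq Λ] {G : (Λ → E) → ℝ}

/-- **The flow map on sphere configurations** `Φ_t : (Λ → S(E)) → (Λ → S(E))`. -/
def sphereFlowMap (hG : ContDiff ℝ 2 G) (t : ℝ) (ω : Λ → sphere (0 : E) 1) : Λ → sphere (0 : E) 1 :=
  fun n => ⟨sphereGradientFlow hG (fun m => (ω m : E)) t n, by
    rw [mem_sphere_zero_iff_norm]
    exact norm_sphereGradientFlow_eq_one hG (fun m => by simp) t n⟩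

/-- The flow map read in the ambient space. -/
@[simp]
theorem coe_sphereFlowMap (hG : ContDiff ℝ 2 G) (t : ℝ) (ω : Λ → sphere (0 : E) 1) (n : Λ) :
    ((sphereFlowMap hG t ω n : sphere (0 : E) 1) : E) = sphereGradientFlow hG (fun m => (ω m : E)) t n :=
  rfl

/-- `Φ_0 = id` on sphere configurations. -/
theorem sphereFlowMap_zero (hG : ContDiff ℝ 2 G) (ω : Λ → sphere (0 : E) 1) :
    sphereFlowMap hG 0 ω = ω := by
  funext n
  ext
  simp

/-- **The group law** on sphere configurations: `Φ_{s+t} = Φ_t ∘ Φ_s`. -/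
theorem sphereFlowMap_add (hG : ContDiff ℝ 2 G) (s t : ℝ) (ω : Λ → sphere (0 : E) 1) :
    sphereFlowMap hG (s + t) ω = sphereFlowMap hG t (sphereFlowMap hG s ω) := by
  funext n
  ext
  simp only [coe_sphereFlowMap, sphereGradientFlow_add]

/-- `Φ_{−t} ∘ Φ_t = id` on sphere configurations. -/
theorem sphereFlowMap_neg_sphereFlowMap (hG : ContDiff ℝ 2 G) (t : ℝ) (ω : Λ → sphere (0 : E) 1) :
    sphereFlowMap hG (-t) (sphereFlowMap hG t ω) = ω := by
  have h := sphereFlowMap_add hG t (-t) ω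
  rw [add_neg_cancel, sphereFlowMap_zero] at h
  exact h.symm

/-- **The flow map is a bijection of `Λ → S(E)`** with inverse `Φ_{−t}`. -/
def sphereFlowEquiv (hG : ContDiff ℝ 2 G) (t : ℝ) : (Λ → sphere (0 : E) 1) ≃ (Λ → sphere (0 : E) 1) where
  toFun := sphereFlowMap hG t
  invFun := sphereFlowMap hG (-t)
  left_inv ω := sphereFlowMap_neg_sphereFlowMap hG t ω
  right_inv ω := by
    have h := sphereFlowMap_neg_sphereFlowMap hG (-t) ω
    rwa [neg_neg] at h

/-- **The flow map is continuous** on sphere configurations. -/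
theorem continuous_sphereFlowMap (hG : ContDiff ℝ 2 G) (t : ℝ) : Continuous (sphereFlowMap hG t) := by
  refine continuous_pi fun n => Continuous.subtype_mk ?_ _
  exact (continuous_apply n).comp ((continuous_sphereGradientFlow hG t).comp continuous_sphereConfig)

variable [MeasurableSpace E] [BorelSpace E]

/-- … hence measurable. -/
theorem measurable_sphereFlowMap (hG : ContDiff ℝ 2 G) (t : ℝ) : Measurable (sphereFlowMap hG t) :=
  (continuous_sphereFlowMap hG t).measurable

end Map

end Summit.Ventures.LatticeQCDFlow.Exactness

end
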